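import Summits.ResolutionOfSingularities.ResolutionOfSingularities.Theorems.EquisingularLiftEquisingularLiftNatSubmaxLinStrictN
import Summits.ResolutionOfSingularities.ResolutionOfSingularities.Theorems.EquisingularLiftEquisingularLiftNatSpecimenLinearCone
import HarnessLib

/-!
# [OURS · EL♮] EVERY HYPERSURFACE OF `ℙ^{r+2}_K̄` OF DEGREE `d + 2` WITH THE CODIMENSION-2 LINEAR SUBSPACE `V(x_{r+1}, x_{r+2})` OF MULTIPLICITY
# `≥ d + 1` — `F = Σ_{j ≤ r} x_j·A_j(x_{r+1},x_{r+2}) + C(x_{r+1},x_{r+2})` — SATISFIES EL♮ AND HAS A REGULAR BLOW-UP MODEL, EVERY `r`, EVERY `p`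
# (crux `Theses.EquisingularLift.EquisingularLiftNat`, stmt-ResolutionOfSingularities-20038; blow-up models: crux `EquisingularLift`, stmt-…-15660)

[OURS · leafhand-res-equisingularlift-7 g0, 2026-08-31; cell `pub/decomp-res`] AI-produced, weaker than expert review; NOT a statement of any
manuscript; nothing here proves resolution of singularities in positive characteristic.  DEF-FREE helper; no `sorry`; standard axioms; ZERO named
hypotheses.  The all-dimension version of `…NatSubmaxLine` (the case `r = 1`, surfaces in `ℙ³`), assembled from `…NatSubmaxLinAlgebraN / ChartsN /
StrictN` with res-D-pv-013's generic linear-centre package (`HypersurfaceSpecimen.isRegular_of_isBlowup_comap_of_charts`,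
`elNatAt_of_linearCentreKill`, p535275): `O = 𝕎(K)`, ONE blow-up of `ℙ^{r+2}_O` along the `O`-flat `ℙʳ_O = V(x_{r+1}, x_{r+2})`.

Hypotheses: `A_j` (`j ≤ r`) binary forms of degree `d + 1`, not all zero; `C` a binary form of degree `d + 2`; `F` prime; `(A_j)_j, C` without
common zero on `ℙ¹` (for `r = 1` both side conditions follow from primality, ✓ `SubmaxLine.elNatAt_of_prime`).

* `isHomogeneous_shape`, `F_mem_span`, `X_killed_not_mem_span`, `radical_span_dehomogenizeN`;
* `isRegularRing_chartRing_killed` (charts off the centre), `isRegularRing_blowupAlgebra_surv` (blow-up charts over the centre, transported through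
  `HypersurfaceSpecimen.exists_chartQuotEquiv` to `SubmaxLine.isRegularRing_strictTransformChartN`);
* ★ `isRegular_of_isBlowup_comap_kill` — every blow-up of `H = V₊(F)` along `Λ·𝒪_H`, `Λ = V(x_{r+1}, x_{r+2})`, is regular;
* ★★ `elNatAt_submaxLinN` — `ELNatAt p K (r+2) V₊(F) ι`, ANY `p`; ★★ `blowupModel_submaxLinN` — `∃ 𝔞 ≠ ⊥` on `V₊(F)` with all blow-ups regular:
  an ALL-DIMENSION, ALL-CHARACTERISTIC instance family of the conclusion of the OPEN residual `stub_blowupModel_ge_five` (e.g. in `ℙ⁵`: quintic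
  fourfolds `x₀A₀ + ⋯ + x₃A₃ + C` with `A_j` binary quartics, quadruple along the plane… the 3-space `V(x₄, x₅)`).

Honest label: no registered stub closed; EL / EL♮ / EL♮(3) NOT proved; resolution in char p NOT proved.
-/

set_option linter.dupNamespace false -- mandated namespace `Summit.<Summit>.<Problem>` of this single-conjunct summit

noncomputable section

open CategoryTheory CategoryTheory.Limits AlgebraicGeometry TopologicalSpace
open MvPolynomial HomogeneousLocalization
open Literature.AlgebraicGeometry.Resolution
open Literature.AlgebraicGeometry.Motives Literature.AlgebraicGeometry.Motives.SmoothHypersurface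
open AlgebraicGeometry.Scheme.IdealSheafData
open Summit.ResolutionOfSingularities.ResolutionOfSingularities.Cruxes.EquisingularLift.StrataSplit

namespace Summit.ResolutionOfSingularities.ResolutionOfSingularities.Cruxes.EquisingularLiftNat.Sections

namespace SubmaxLinN

variable (K : Type) [Field K] {r : ℕ}

/-- **All dehomogenisations of a prime form span radical ideals** (irreducible or unit: tree `irreducible_or_isUnit_dehomogenize`).
[cite: Hartshorne1977, I §2, Ex. 2.10] -/
theorem radical_span_dehomogenizeN {N : ℕ} (F : MvPolynomial (Fin (N + 1)) K) {e : ℕ} (hFh : F.IsHomogeneous e) (hFp : Prime F)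
    (c : Fin (N + 1)) :
    (Ideal.span {ProjectiveSpace.dehomogenize K c F}).radical = Ideal.span {ProjectiveSpace.dehomogenize K c F} := by
  rcases ProjectiveSpace.irreducible_or_isUnit_dehomogenize (i := c) hFh hFp.irreducible with hirr | hu
  · exact ((Ideal.span_singleton_prime hirr.ne_zero).mpr (UniqueFactorizationMonoid.irreducible_iff_prime.mp hirr)).radical
  · rw [Ideal.span_singleton_eq_top.mpr hu, Ideal.radical_top]

section Family

variable {d : ℕ} (A : Fin (r + 1) → MvPolynomial (Fin 2) K) (C : MvPolynomial (Fin 2) K)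
  (hA : ∀ j, (A j).IsHomogeneous (d + 1)) (hC : C.IsHomogeneous (d + 2)) (F : MvPolynomial (Fin (r + 1 + 1 + 1)) K)
  (hF : F = ∑ j : Fin (r + 1), (X (j.castSucc.castSucc) : MvPolynomial (Fin (r + 1 + 1 + 1)) K) *
      rename (fun b : Fin 2 => (⟨r + 1 + b, by omega⟩ : Fin (r + 1 + 1 + 1))) (A j) +
    rename (fun b : Fin 2 => (⟨r + 1 + b, by omega⟩ : Fin (r + 1 + 1 + 1))) C)

include hA hC in
/-- The shape `Σ_j x_j·A_j(x_{r+1},x_{r+2}) + C(x_{r+1},x_{r+2})` is homogeneous of degree `d + 2`. [folklore] -/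
theorem isHomogeneous_shape :
    (∑ j : Fin (r + 1), (X (j.castSucc.castSucc) : MvPolynomial (Fin (r + 1 + 1 + 1)) K) *
        rename (fun b : Fin 2 => (⟨r + 1 + b, by omega⟩ : Fin (r + 1 + 1 + 1))) (A j) +
      rename (fun b : Fin 2 => (⟨r + 1 + b, by omega⟩ : Fin (r + 1 + 1 + 1))) C).IsHomogeneous (d + 2) := by
  refine (IsHomogeneous.sum _ _ _ fun j _ => ?_).add hC.rename_isHomogeneous
  have h := (isHomogeneous_X K (j.castSucc.castSucc : Fin (r + 1 + 1 + 1))).mul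
    ((hA j).rename_isHomogeneous (f := fun b : Fin 2 => (⟨r + 1 + b, by omega⟩ : Fin (r + 1 + 1 + 1))))
  rwa [show 1 + (d + 1) = d + 2 by omega] at h

variable (hFh : F.IsHomogeneous (d + 2))

/-- A binary form of positive degree, placed in the killed variables, lies in `(x_{r+1}, x_{r+2})`. [folklore] -/
theorem rename_mem_span_killed (G : MvPolynomial (Fin 2) K) {m : ℕ} (hG : G.IsHomogeneous m) (hm : 0 < m) :
    rename (fun b : Fin 2 => (⟨r + 1 + b, by omega⟩ : Fin (r + 1 + 1 + 1))) G ∈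
      Ideal.span (Set.range fun b : Fin 2 => (X (⟨r + 1 + b, by omega⟩ : Fin (r + 1 + 1 + 1)) : MvPolynomial (Fin (r + 1 + 1 + 1)) K)) := by
  classical
  have hG0 : G.coeff 0 = 0 := hG.coeff_eq_zero (by
    rw [map_zero]
    omega)
  have hmem : G ∈ Ideal.span (Set.range (X : Fin 2 → MvPolynomial (Fin 2) K)) := by
    rw [← Set.image_univ, MvPolynomial.mem_ideal_span_X_image]
    intro s hs
    have hs0 : s ≠ 0 := by
      rintro rfl
      exact (mem_support_iff.mp hs) hG0
    obtain ⟨j, hj⟩ := Finsupp.ne_iff.mp hs0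
    exact ⟨j, Set.mem_univ _, hj⟩
  have h := Ideal.mem_map_of_mem (rename (fun b : Fin 2 => (⟨r + 1 + b, by omega⟩ : Fin (r + 1 + 1 + 1))) :
    MvPolynomial (Fin 2) K →ₐ[K] MvPolynomial (Fin (r + 1 + 1 + 1)) K) hmem
  rw [Ideal.map_span, ← Set.range_comp] at h
  refine Ideal.span_mono ?_ h
  rintro _ ⟨b, rfl⟩
  exact ⟨b, by simp [rename_X]⟩

include hA hC hF in
/-- **`F ∈ (x_{r+1}, x_{r+2})`** — the centre `V(x_{r+1}, x_{r+2})` lies on `H`. [folklore] -/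
theorem F_mem_span :
    F ∈ Ideal.span (Set.range fun b : Fin 2 => (X (⟨r + 1 + b, by omega⟩ : Fin (r + 1 + 1 + 1)) : MvPolynomial (Fin (r + 1 + 1 + 1)) K)) := by
  rw [hF]
  refine Ideal.add_mem _ (Ideal.sum_mem _ fun j _ => Ideal.mul_mem_left _ _ (rename_mem_span_killed K (A j) (hA j) (by omega)))
    (rename_mem_span_killed K C hC (by omega))

include hFh in
/-- **`x_{r+1} ∉ (F)`** (degrees). [folklore] -/
theorem X_killed_not_mem_span (hF0 : F ≠ 0) :
    (X (⟨r + 1 + ((0 : Fin 2) : ℕ), by omega⟩ : Fin (r + 1 + 1 + 1)) : MvPolynomial (Fin (r + 1 + 1 + 1)) K) ∉ Ideal.span {F} := by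
  intro h
  obtain ⟨q, hq⟩ := Ideal.mem_span_singleton'.mp h
  have hq0 : q ≠ 0 := by
    rintro rfl
    rw [zero_mul] at hq
    exact X_ne_zero _ hq.symm
  have hdeg := congrArg MvPolynomial.totalDegree hq
  rw [totalDegree_mul_of_isDomain hq0 hF0, hFh.totalDegree hF0, totalDegree_X] at hdeg
  omega

/-! ## The chart rings -/

include hF hFh in
/-- **The chart rings off the centre are regular**: `ChartRing F x_{r+1+b} ≅ K[y]/(F(x_{r+1+b} := 1))`. [folklore] -/
theorem isRegularRing_chartRing_killed [IsAlgClosed K] (hprime : Prime F)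
    (hnc : ∀ v : Fin 2 → K, v ≠ 0 → ¬ ((∀ j, MvPolynomial.eval v (A j) = 0) ∧ MvPolynomial.eval v C = 0)) (b : Fin 2) :
    IsRegularRing (ChartRing F (⟨r + 1 + b, by omega⟩ : Fin (r + 1 + 1 + 1)) hFh) := by
  have hrad := radical_span_dehomogenizeN K F hFh hprime (⟨r + 1 + b, by omega⟩ : Fin (r + 1 + 1 + 1))
  obtain ⟨θ, -⟩ := HypersurfaceSpecimen.exists_chartQuotEquiv F hFh (⟨r + 1 + b, by omega⟩ : Fin (r + 1 + 1 + 1)) _ rfl hrad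
  haveI := isRegularRing_quotient_dehomogenize_killed K A C F hF hnc b
  exact IsRegularRing.of_ringEquiv θ.symm

include hA hC hF hFh in
/-- **The blow-up chart rings over the centre charts are regular**: on `c = x_i` the centre is `(x_{r+1}/x_i, x_{r+2}/x_i) ↦ (ȳ_r, ȳ_{r+1})`
under `ChartRing F x_i ≅ K[y]/(F(x_i := 1))`; the chart at `x_{r+1+b}/x_i` is the strict-transform chart of `…StrictN`
(`SubmaxLine.isRegularRing_strictTransformChartN`). [cite: StacksProject, Tag 0804] -/
theorem isRegularRing_blowupAlgebra_surv [IsAlgClosed K] (hprime : Prime F) (hAne : ∃ j, A j ≠ 0)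
    (hnc : ∀ v : Fin 2 → K, v ≠ 0 → ¬ ((∀ j, MvPolynomial.eval v (A j) = 0) ∧ MvPolynomial.eval v C = 0)) (i : Fin (r + 1))
    (a : {a : Fin (r + 1 + 1 + 1) // a ∉ Set.range (fun j : Fin (r + 1) => (j.castSucc.castSucc : Fin (r + 1 + 1 + 1)))}) :
    IsRegularRing (blowupAlgebra
      (Ideal.span (Set.range fun a' : {a' : Fin (r + 1 + 1 + 1) // a' ∉ Set.range (fun j : Fin (r + 1) => (j.castSucc.castSucc : Fin (r + 1 + 1 + 1)))} =>
        tautVec F (i.castSucc.castSucc) hFh a'.1))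
      (tautVec F (i.castSucc.castSucc) hFh a.1)) := by
  classical
  have hrad := radical_span_dehomogenizeN K F hFh hprime (i.castSucc.castSucc : Fin (r + 1 + 1 + 1))
  obtain ⟨θ, hθ⟩ := HypersurfaceSpecimen.exists_chartQuotEquiv F hFh (i.castSucc.castSucc : Fin (r + 1 + 1 + 1)) _ rfl hrad
  obtain ⟨b, hb⟩ := exists_eq_killed (r := r) a.2
  have hθa : θ (tautVec F (i.castSucc.castSucc) hFh a.1) = Ideal.Quotient.mk _ (X ⟨r + b, by omega⟩) := by
    rw [hb, ← succAbove_surv_cen i b]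
    exact hθ _
  have hI : (Ideal.span (Set.range fun a' : {a' : Fin (r + 1 + 1 + 1) //
        a' ∉ Set.range (fun j : Fin (r + 1) => (j.castSucc.castSucc : Fin (r + 1 + 1 + 1)))} =>
        tautVec F (i.castSucc.castSucc) hFh a'.1)).map θ.toRingHom =
      (Ideal.span (X '' {l : Fin (r + 1 + 1) | r ≤ (l : ℕ)})).map
        (Ideal.Quotient.mk (Ideal.span {ProjectiveSpace.dehomogenize K (i.castSucc.castSucc : Fin (r + 1 + 1 + 1)) F})) := by
    rw [Ideal.map_span, Ideal.map_span, ← Set.range_comp]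
    congr 1
    ext q
    constructor
    · rintro ⟨a', rfl⟩
      obtain ⟨b', hb'⟩ := exists_eq_killed (r := r) a'.2
      refine ⟨X ⟨r + b', by omega⟩, ⟨⟨r + b', by omega⟩, by simp, rfl⟩, ?_⟩
      simp only [Function.comp_apply, RingEquiv.toRingHom_eq_coe, RingHom.coe_coe]
      rw [hb', ← succAbove_surv_cen i b', hθ]
    · rintro ⟨_, ⟨l, hl, rfl⟩, rfl⟩
      have hl' : r ≤ (l : ℕ) := hl
      have hl2 := l.2
      let b' : Fin 2 := ⟨(l : ℕ) - r, by omega⟩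
      have hlb : l = ⟨r + b', by omega⟩ := Fin.ext (by simp [b']; omega)
      refine ⟨⟨⟨r + 1 + b', by omega⟩, killed_not_mem_range b'⟩, ?_⟩
      simp only [Function.comp_apply, RingEquiv.toRingHom_eq_coe, RingHom.coe_coe]
      rw [← succAbove_surv_cen i b', hθ, hlb]
  refine WhitneyCubic.isRegularRing_blowupAlgebra_of_ringEquiv θ _ _ ?_
  rw [hI, hθa]
  exact SubmaxLine.isRegularRing_strictTransformChartN K {l : Fin (r + 1 + 1) | r ≤ (l : ℕ)} _ _ ⟨r + b, by omega⟩ (d + 1)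
    (subst_dehomogenize_surv K A C hA hC F hF i b) (not_X_dvd_strict K A C hA i b hAne) (isRegularRing_quotient_strict K A C i b hnc)

include hA hC hF hFh in
/-- ★ **EVERY BLOW-UP OF `H = V₊(F)` ALONG `Λ·𝒪_H` IS REGULAR**, `Λ = ker Proj(f_K)` the kill-map ideal sheaf of the coordinate `ℙʳ = V(x_{r+1}, x_{r+2})`
(`HypersurfaceSpecimen.isRegular_of_isBlowup_comap_of_charts`, p535275, with the chart rings above). [OURS · lh7] [cite: StacksProject, Tag 0804] -/
theorem isRegular_of_isBlowup_comap_kill [IsAlgClosed K] (hprime : Prime F) (hAne : ∃ j, A j ≠ 0)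
    (hnc : ∀ v : Fin 2 → K, v ≠ 0 → ¬ ((∀ j, MvPolynomial.eval v (A j) = 0) ∧ MvPolynomial.eval v C = 0)) :
    letI := MvPolynomial.gradedAlgebra (σ := Fin (r + 1 + 1 + 1)) (R := K)
    letI := MvPolynomial.gradedAlgebra (σ := Fin (r + 1)) (R := K)
    ∀ (fk : homogeneousSubmodule (Fin (r + 1 + 1 + 1)) K →+*ᵍ homogeneousSubmodule (Fin (r + 1)) K)
      (hfk' : HomogeneousIdeal.irrelevant (homogeneousSubmodule (Fin (r + 1)) K) ≤
        (HomogeneousIdeal.irrelevant (homogeneousSubmodule (Fin (r + 1 + 1 + 1)) K)).map fk)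
      (_ : ∀ a : K, fk (MvPolynomial.C a) = MvPolynomial.C a)
      (_ : ∀ j : Fin (r + 1), fk (X ((fun j : Fin (r + 1) => (j.castSucc.castSucc : Fin (r + 1 + 1 + 1))) j)) = X j)
      (_ : ∀ i : Fin (r + 1 + 1 + 1), i ∉ Set.range (fun j : Fin (r + 1) => (j.castSucc.castSucc : Fin (r + 1 + 1 + 1))) → fk (X i) = 0)
      (Z : Scheme.{0}) (ρ : Z ⟶ (hypersurface F).left),
      IsBlowup ρ ((Proj.map fk hfk').ker.comap (hypersurfaceι F).left) → Scheme.IsRegular Z := by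
  intro fk hfk' hfkC hfke hfk0 Z ρ hρ
  have hinj : Function.Injective (fun j : Fin (r + 1) => (j.castSucc.castSucc : Fin (r + 1 + 1 + 1))) := fun j j' h =>
    Fin.castSucc_injective _ (Fin.castSucc_injective _ h)
  refine HypersurfaceSpecimen.isRegular_of_isBlowup_comap_of_charts K F hFh (by omega)
    (fun j : Fin (r + 1) => (j.castSucc.castSucc : Fin (r + 1 + 1 + 1))) hinj fk hfk' hfkC hfke hfk0 ?_ ?_ Z ρ hρ
  · intro c hc
    obtain ⟨b, rfl⟩ := exists_eq_killed (r := r) hc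
    exact isRegularRing_chartRing_killed K A C F hF hFh hprime hnc b
  · rintro c ⟨i, rfl⟩ a
    exact isRegularRing_blowupAlgebra_surv K A C hA hC F hF hFh hprime hAne hnc i a

include hA hC hF hFh in
/-- ★★ **EL♮ FOR EVERY HYPERSURFACE `V₊(Σ_{j≤r} x_j·A_j(x_{r+1},x_{r+2}) + C(x_{r+1},x_{r+2})) ⊂ ℙ^{r+2}_K`**, `K` algebraically closed of
characteristic `p`, ANY `p`, ANY `r`: `ELNatAt p K (r+2) V₊(F) ι` — `A_j` binary forms of degree `d + 1` not all zero, `C` of degree `d + 2`, `F`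
prime, `(A_j)_j, C` without common zero on `ℙ¹`.  Witness: `O = 𝕎(K)`, ONE blow-up of `ℙ^{r+2}_O` along the `O`-flat `ℙʳ_O = V(x_{r+1}, x_{r+2})`
(`elNatAt_of_linearCentreKill`).  `r = 1` is `SubmaxLine.elNatAt_submaxLine`. [OURS · lh7] [cite: Hartshorne1977, I Ex. 5.12] -/
theorem elNatAt_submaxLinN (p : ℕ) (hp : p.Prime) [CharP K p] [IsAlgClosed K] (hprime : Prime F) (hAne : ∃ j, A j ≠ 0)
    (hnc : ∀ v : Fin 2 → K, v ≠ 0 → ¬ ((∀ j, MvPolynomial.eval v (A j) = 0) ∧ MvPolynomial.eval v C = 0)) :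
    Theorems.EquisingularLift.ELNatAt p K (r + 1 + 1) (hypersurface F).left (hypersurfaceι F).left := by
  classical
  letI := MvPolynomial.gradedAlgebra (σ := Fin (r + 1 + 1 + 1)) (R := K)
  letI := MvPolynomial.gradedAlgebra (σ := Fin (r + 1)) (R := K)
  have hinj : Function.Injective (fun j : Fin (r + 1) => (j.castSucc.castSucc : Fin (r + 1 + 1 + 1))) := fun j j' h =>
    Fin.castSucc_injective _ (Fin.castSucc_injective _ h)
  obtain ⟨fk, hfk', hfkC, hfke, hfk0⟩ :=
    LinearCentre.exists_kill (R := K) (fun j : Fin (r + 1) => (j.castSucc.castSucc : Fin (r + 1 + 1 + 1))) hinj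
  haveI := HypersurfaceSpecimen.isIntegral_hypersurface_of_prime K F hFh hprime
  refine elNatAt_of_linearCentreKill p hp K _ hinj _ (hypersurfaceι F).left fk hfk' hfkC hfke hfk0 ?_ ?_
    (fun Z ρ hρ => isRegular_of_isBlowup_comap_kill K A C hA hC F hF hFh hprime hAne hnc fk hfk' hfkC hfke hfk0 Z ρ hρ)
  · -- `V(Λ) ⊆ V₊(F)`
    intro x hx
    have hX : ∀ b : Fin 2, (X (⟨r + 1 + b, by omega⟩ : Fin (r + 1 + 1 + 1)) : MvPolynomial (Fin (r + 1 + 1 + 1)) K) ∈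
        x.asHomogeneousIdeal := fun b =>
      LinearCentre.X_mem_asHomogeneousIdeal_of_mem_support _ fk hfk' hfkC hfke hfk0 hx (killed_not_mem_range b)
    refine (Set.ext_iff.mp (range_hypersurfaceι F) x).mpr
      ((ProjectiveSpectrum.mem_zeroLocus _ _ _).mpr (Set.singleton_subset_iff.mpr ?_))
    change F ∈ x.asHomogeneousIdeal
    exact (Ideal.span_le.mpr (Set.range_subset_iff.mpr hX)) (F_mem_span K A C hA hC F hF)
  · -- `V₊(F) ⊄ V(Λ)`
    intro h
    have hmem : (pointOfPrime F hFh hprime : Proj (homogeneousSubmodule (Fin (r + 1 + 1 + 1)) K)) ∈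
        Set.range (hypersurfaceι F).left := by
      refine (Set.ext_iff.mp (range_hypersurfaceι F) _).mpr
        ((ProjectiveSpectrum.mem_zeroLocus _ _ _).mpr (Set.singleton_subset_iff.mpr ?_))
      exact Ideal.subset_span rfl
    exact X_killed_not_mem_span K F hFh hprime.ne_zero
      (LinearCentre.X_mem_asHomogeneousIdeal_of_mem_support _ fk hfk' hfkC hfke hfk0 (h hmem) (killed_not_mem_range 0))

include hA hC hF hFh in
/-- ★★ **REGULAR BLOW-UP MODEL, EVERY DIMENSION, EVERY CHARACTERISTIC** — the conclusion of crux `EquisingularLift`'s OPEN residual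
`stub_blowupModel_ge_five` at these hypersurfaces: `V₊(Σ_{j≤r} x_j·A_j + C(x_{r+1},x_{r+2})) ⊂ ℙ^{r+2}_K̄` carries a non-zero ideal sheaf —
`Λ·𝒪_H`, the trace of `V(x_{r+1}, x_{r+2})` — all of whose blow-ups are regular. [OURS · lh7] [cite: StacksProject, Tag 0804] -/
theorem blowupModel_submaxLinN [IsAlgClosed K] (hprime : Prime F) (hAne : ∃ j, A j ≠ 0)
    (hnc : ∀ v : Fin 2 → K, v ≠ 0 → ¬ ((∀ j, MvPolynomial.eval v (A j) = 0) ∧ MvPolynomial.eval v C = 0)) :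
    ∃ 𝔞 : (hypersurface F).left.IdealSheafData, 𝔞 ≠ ⊥ ∧
      ∀ (Z : Scheme.{0}) (π : Z ⟶ (hypersurface F).left), IsBlowup π 𝔞 → Scheme.IsRegular Z := by
  classical
  letI := MvPolynomial.gradedAlgebra (σ := Fin (r + 1 + 1 + 1)) (R := K)
  letI := MvPolynomial.gradedAlgebra (σ := Fin (r + 1)) (R := K)
  have hinj : Function.Injective (fun j : Fin (r + 1) => (j.castSucc.castSucc : Fin (r + 1 + 1 + 1))) := fun j j' h =>
    Fin.castSucc_injective _ (Fin.castSucc_injective _ h)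
  obtain ⟨fk, hfk', hfkC, hfke, hfk0⟩ :=
    LinearCentre.exists_kill (R := K) (fun j : Fin (r + 1) => (j.castSucc.castSucc : Fin (r + 1 + 1 + 1))) hinj
  refine ⟨(Proj.map fk hfk').ker.comap (hypersurfaceι F).left, ?_,
    fun Z ρ hρ => isRegular_of_isBlowup_comap_kill K A C hA hC F hF hFh hprime hAne hnc fk hfk' hfkC hfke hfk0 Z ρ hρ⟩
  intro h0
  have hmem : (pointOfPrime F hFh hprime : Proj (homogeneousSubmodule (Fin (r + 1 + 1 + 1)) K)) ∈
      Set.range (hypersurfaceι F).left := by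
    refine (Set.ext_iff.mp (range_hypersurfaceι F) _).mpr
      ((ProjectiveSpectrum.mem_zeroLocus _ _ _).mpr (Set.singleton_subset_iff.mpr ?_))
    exact Ideal.subset_span rfl
  obtain ⟨x, hx⟩ := hmem
  have hxs : x ∈ (((Proj.map fk hfk').ker.comap (hypersurfaceι F).left).support : Set (hypersurface F).left) := by
    rw [h0, Scheme.IdealSheafData.support_bot]; trivial
  rw [Scheme.IdealSheafData.support_comap] at hxs
  have hxs' : (hypersurfaceι F).left x ∈ ((Proj.map fk hfk').ker.support : Set (Proj (homogeneousSubmodule (Fin (r + 1 + 1 + 1)) K))) := hxs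
  rw [hx] at hxs'
  exact X_killed_not_mem_span K F hFh hprime.ne_zero
    (LinearCentre.X_mem_asHomogeneousIdeal_of_mem_support _ fk hfk' hfkC hfke hfk0 hxs' (killed_not_mem_range 0))

end Family

end SubmaxLinN

end Summit.ResolutionOfSingularities.ResolutionOfSingularities.Cruxes.EquisingularLiftNat.Sections

end
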